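import Mathlib
import Literature.Analysis.UnboundedOperators.HeatKernel

/-!
# Clause 13-J/13-R, brick B5/B8 (frequency cut-offs): `L²` DOMINATION BY AN `L¹` MAJORANT and the
# CUT-OFF COMMUTATORS `[k∗, w∂_τ]` (first order, Calderón-type) and `[k∗, B]` (zeroth order)

Route `FilamentSkeletonRss`, child `Clause13RNearStraightL` (stmt-NavierStokesRegularity-23612; typing-agnostic, valid verbatim for
the 13-J twins 23321/28296); design of record `filament-plan/DESIGN-NOTE-28296-tenure-g22.md` §4 ("Frequency cut-offs `χ(μD)`:
`‖[χ(μD), w∂_τ]‖ ≲ Λ` (Calderón commutator, needs only `w′ ∈ L∞` — exactly the class), `‖[χ(μD), B]‖ ≲ μ‖B′‖_∞`") and §5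
("cut-off/transport commutators need only `w′ ∈ L∞`").  The band/slice bricks already landed (`…Clause13ModelMourre`,
`…Clause13BandVirial`, `…Clause13HighSliceForm`, `…Clause13LowSliceForm`, `…Clause13SliceBernstein`) are stated for FREQUENCY-LOCALISED
variations; localising a general ball-supported `Y` costs exactly the two commutators of this file.  In physical space a smooth
frequency cut-off is the convolution `f ↦ ∫ k(x−y) f(y) dy` with a real kernel `k` (`k = μ⁻¹ǩ(·/μ)`), and for such kernels the
"Calderón" commutator is ELEMENTARY (one integration by parts puts the derivative on the kernel):

* §1 `eLpNorm_two_le_of_norm_le_integral_mul` / `integral_sq_norm_le_of_norm_le_integral_mul` — **Schur–Young domination**: if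
  `‖g(x)‖ ≤ ∫ K(x−y)‖f(y)‖ dy` with `K ≥ 0` integrable, then `‖g‖₂ ≤ ‖K‖₁‖f‖₂` (the tree's Minkowski/Young endpoint
  `Literature.Analysis.UnboundedOperators.eLpNorm_convolution_le_lintegral_enorm_mul`, `b = 1`);
* §2 `integral_kernel_mul_sub_mul_deriv_eq` — **the first-order commutator kernel**: for `f ∈ C¹_c`, `w` differentiable,
  `∫ k(x−y)(w(y) − w(x)) f′(y) dy = ∫ [k′(x−y)(w(y) − w(x)) − k(x−y)w′(y)] f(y) dy`, whence, with `|w′| ≤ Λ`,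
  `‖[k∗, w]f′ (x)‖ ≤ Λ ∫ (|x−y|·|k′(x−y)| + |k(x−y)|)‖f(y)‖ dy` and
  `‖[k∗, w]∂f‖₂ ≤ Λ·(‖t·k′‖₁ + ‖k‖₁)·‖f‖₂` (`integral_sq_norm_transportCommutator_le`);
* §3 the zeroth-order commutator `‖[k∗, B]f‖₂ ≤ L_B·‖t·k‖₁·‖f‖₂` for a Lipschitz multiplier `B` (`integral_sq_norm_multiplierCommutator_le`);
* §4 scale invariance of the two constants under `k ↦ k_μ = μ⁻¹k(·/μ)`: `‖k_μ‖₁ = ‖k‖₁`, `‖t·k_μ′‖₁ = ‖t·k′‖₁`, `‖t·k_μ‖₁ = μ‖t·k‖₁` —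
  so the transport commutator is `O(Λ)` UNIFORMLY in the core width `μ` (order zero), and the multiplier commutator GAINS a factor `μ`,
  as the note asserts.
Lane ns-filament-19175-p1 g16; `--supports stmt-NavierStokesRegularity-23612 --as helper`.
HONEST FRAMING: elementary harmonic analysis attached to a HYPOTHETICAL filament skeleton's linearised operator on the NEGATIVE side of a
MODEL route; nothing here bears on Navier–Stokes regularity or blow-up.
-/

noncomputable section

open MeasureTheory Real Complex Filter Set
open scoped ComplexConjugate Convolution ENNReal

namespace Summit.NavierStokesRegularity.NavierStokesRegularity.Theorems.MatchedKernel
set_option linter.dupNamespace false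

/-! ## 1. Schur–Young domination: `‖g‖ ≤ K∗‖f‖` pointwise with `K ≥ 0`, `K ∈ L¹` ⟹ `‖g‖₂ ≤ ‖K‖₁‖f‖₂` -/

/-- The explicit-integral form of the real convolution: `(K ⋆ φ)(x) = ∫ K(x−y) φ(y) dy`. [folklore] -/
theorem convolution_lsmul_eq_integral_sub (K φ : ℝ → ℝ) (x : ℝ) :
    (K ⋆[ContinuousLinearMap.lsmul ℝ ℝ, volume] φ) x = ∫ y, K (x - y) * φ y := by
  rw [convolution_eq_swap]
  simp only [ContinuousLinearMap.lsmul_apply, smul_eq_mul]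

/-- **SCHUR–YOUNG DOMINATION (`eLpNorm` form).**  If `‖g x‖ ≤ ∫ K(x−y)‖f y‖ dy` for a.e. `x`, then
`‖g‖_{L²} ≤ (∫⁻‖K‖ₑ)·‖f‖_{L²}`. [folklore] -/
theorem eLpNorm_two_le_of_norm_le_integral_mul {K : ℝ → ℝ} (hK : AEStronglyMeasurable K volume)
    {E : Type*} [NormedAddCommGroup E] {f : ℝ → E} (hf : AEStronglyMeasurable f volume)
    {E' : Type*} [NormedAddCommGroup E'] {g : ℝ → E'}
    (hdom : ∀ᵐ x ∂volume, ‖g x‖ ≤ ∫ y, K (x - y) * ‖f y‖) :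
    eLpNorm g 2 volume ≤ (∫⁻ t, ‖K t‖ₑ) * eLpNorm f 2 volume := by
  have h1 : eLpNorm g 2 volume
      ≤ eLpNorm (K ⋆[ContinuousLinearMap.lsmul ℝ ℝ, volume] fun y => ‖f y‖) 2 volume := by
    refine eLpNorm_mono_ae_real (hdom.mono fun x hx => ?_)
    rwa [convolution_lsmul_eq_integral_sub]
  have h2 := Literature.Analysis.UnboundedOperators.eLpNorm_convolution_le_lintegral_enorm_mul
    (μ := volume) hK (f := fun y => ‖f y‖) hf.norm (p := 2) (by norm_num)
  rw [eLpNorm_norm] at h2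
  exact h1.trans h2

/-- **SCHUR–YOUNG DOMINATION (integral form).**  If `‖g x‖ ≤ ∫ K(x−y)‖f y‖ dy` for a.e. `x` with `K` integrable,
`f ∈ L²` and `g` a.e.-strongly measurable, then `g ∈ L²` and `∫‖g‖² ≤ (∫|K|)²·∫‖f‖²`. [folklore] -/
theorem integral_sq_norm_le_of_norm_le_integral_mul {K : ℝ → ℝ} (hK : Integrable K)
    {E : Type*} [NormedAddCommGroup E] [NormedSpace ℝ E] {f : ℝ → E} (hf : MemLp f 2 volume)
    {E' : Type*} [NormedAddCommGroup E'] [NormedSpace ℝ E'] {g : ℝ → E'} (hg : AEStronglyMeasurable g volume)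
    (hdom : ∀ᵐ x ∂volume, ‖g x‖ ≤ ∫ y, K (x - y) * ‖f y‖) :
    MemLp g 2 volume ∧ ∫ x, ‖g x‖ ^ 2 ≤ (∫ t, |K t|) ^ 2 * ∫ y, ‖f y‖ ^ 2 := by
  have hle := eLpNorm_two_le_of_norm_le_integral_mul hK.aestronglyMeasurable hf.aestronglyMeasurable hdom
  have hKe : ∫⁻ t, ‖K t‖ₑ = ENNReal.ofReal (∫ t, |K t|) := by
    rw [← ofReal_integral_norm_eq_lintegral_enorm hK]
    simp only [Real.norm_eq_abs]
  have hM0 : 0 ≤ ∫ t, |K t| := integral_nonneg fun t => abs_nonneg _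
  have hgLp : MemLp g 2 volume := by
    refine ⟨hg, lt_of_le_of_lt hle ?_⟩
    rw [hKe]
    exact ENNReal.mul_lt_top ENNReal.ofReal_lt_top hf.eLpNorm_lt_top
  refine ⟨hgLp, ?_⟩
  have h2 : (2 : ℝ≥0∞) ≠ 0 := by norm_num
  have h2' : (2 : ℝ≥0∞) ≠ ∞ := by norm_num
  rw [hgLp.eLpNorm_eq_integral_rpow_norm h2 h2', hf.eLpNorm_eq_integral_rpow_norm h2 h2', hKe,
    ← ENNReal.ofReal_mul hM0] at hle
  simp only [ENNReal.toReal_ofNat, Real.rpow_two] at hle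
  have hIf : 0 ≤ ∫ y, ‖f y‖ ^ 2 := integral_nonneg fun y => by positivity
  have hIg : 0 ≤ ∫ x, ‖g x‖ ^ 2 := integral_nonneg fun x => by positivity
  have hle' := (ENNReal.ofReal_le_ofReal_iff (by positivity)).1 hle
  -- `(∫‖g‖²)^{1/2} ≤ M·(∫‖f‖²)^{1/2}`; square both sides
  have hsq := mul_self_le_mul_self (by positivity) hle'
  have ha : (∫ x, ‖g x‖ ^ 2) ^ (2⁻¹ : ℝ) * (∫ x, ‖g x‖ ^ 2) ^ (2⁻¹ : ℝ) = ∫ x, ‖g x‖ ^ 2 := by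
    rw [← Real.rpow_add' hIg (by norm_num)]; norm_num
  have hb : (∫ y, ‖f y‖ ^ 2) ^ (2⁻¹ : ℝ) * (∫ y, ‖f y‖ ^ 2) ^ (2⁻¹ : ℝ) = ∫ y, ‖f y‖ ^ 2 := by
    rw [← Real.rpow_add' hIf (by norm_num)]; norm_num
  calc ∫ x, ‖g x‖ ^ 2 = (∫ x, ‖g x‖ ^ 2) ^ (2⁻¹ : ℝ) * (∫ x, ‖g x‖ ^ 2) ^ (2⁻¹ : ℝ) := ha.symm
    _ ≤ ((∫ t, |K t|) * (∫ y, ‖f y‖ ^ 2) ^ (2⁻¹ : ℝ)) * ((∫ t, |K t|) * (∫ y, ‖f y‖ ^ 2) ^ (2⁻¹ : ℝ)) := hsq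
    _ = (∫ t, |K t|) ^ 2 * ((∫ y, ‖f y‖ ^ 2) ^ (2⁻¹ : ℝ) * (∫ y, ‖f y‖ ^ 2) ^ (2⁻¹ : ℝ)) := by ring
    _ = (∫ t, |K t|) ^ 2 * ∫ y, ‖f y‖ ^ 2 := by rw [hb]


/-! ## 2. The first-order (transport) commutator `[k∗, w]∂`: kernel identity, pointwise domination, `L²` bound -/

/-- Lipschitz bound from a derivative bound: `|w′| ≤ Λ` everywhere ⟹ `|w(y) − w(x)| ≤ Λ|y − x|` (mean value inequality). [folklore] -/
theorem abs_sub_le_of_abs_deriv_le {w : ℝ → ℝ} (hw : Differentiable ℝ w) {Λ : ℝ} (hΛ : ∀ t, |deriv w t| ≤ Λ)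
    (x y : ℝ) : |w y - w x| ≤ Λ * |y - x| := by
  have h := Convex.norm_image_sub_le_of_norm_deriv_le (f := w) (s := Set.univ) (fun t _ => hw t)
    (fun t _ => by rw [Real.norm_eq_abs]; exact hΛ t) convex_univ (Set.mem_univ x) (Set.mem_univ y)
  simpa only [Real.norm_eq_abs] using h

/-- Derivative of the commutator weight `y ↦ k(x−y)·(w(y) − w(x))`. [folklore] -/
theorem hasDerivAt_kernel_mul_sub {k k' : ℝ → ℝ} (hk : ∀ t, HasDerivAt k (k' t) t) {w : ℝ → ℝ}
    (hw : Differentiable ℝ w) (x y : ℝ) :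
    HasDerivAt (fun y => k (x - y) * (w y - w x)) (-k' (x - y) * (w y - w x) + k (x - y) * deriv w y) y := by
  have h1 : HasDerivAt (fun y => k (x - y)) (-k' (x - y)) y := by
    have h := (hk (x - y)).comp y ((hasDerivAt_id y).const_sub x)
    have h' : HasDerivAt (fun y => k (x - y)) (k' (x - y) * -1) y := h
    convert h' using 1
    ring
  have h2 : HasDerivAt (fun y => w y - w x) (deriv w y) y := (hw y).hasDerivAt.sub_const (w x)
  exact h1.mul h2

/-- **FIRST-ORDER COMMUTATOR KERNEL (integration by parts).**  For a `C¹` kernel `k`, a differentiable `w` with bounded derivative and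
`f ∈ C¹_c`:  `∫ k(x−y)(w(y) − w(x)) f′(y) dy = ∫ [k′(x−y)(w(y) − w(x)) − k(x−y)w′(y)] f(y) dy`.  The left side is the commutator
`(k∗(w f′))(x) − w(x)(k∗f′)(x)` written as one integral; on the right the derivative has moved to the kernel. [folklore] -/
theorem integral_kernel_mul_sub_mul_deriv_eq {k k' : ℝ → ℝ} (hk : ∀ t, HasDerivAt k (k' t) t) (hk'c : Continuous k')
    {w : ℝ → ℝ} (hw : Differentiable ℝ w) {Λ : ℝ} (hΛ : ∀ t, |deriv w t| ≤ Λ)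
    {f f' : ℝ → ℂ} (hf : ∀ y, HasDerivAt f (f' y) y) (hf'c : Continuous f') (hfs : HasCompactSupport f) (x : ℝ) :
    ∫ y, ((k (x - y) * (w y - w x) : ℝ) : ℂ) * f' y
      = ∫ y, ((k' (x - y) * (w y - w x) - k (x - y) * deriv w y : ℝ) : ℂ) * f y := by
  have hkc : Continuous k := continuous_iff_continuousAt.2 fun t => (hk t).continuousAt
  have hwc : Continuous w := hw.continuous
  have hfc : Continuous f := continuous_iff_continuousAt.2 fun t => (hf t).continuousAt
  have hf's : HasCompactSupport f' := by
    have h : deriv f = f' := funext fun y => (hf y).deriv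
    rw [← h]
    exact hfs.deriv
  have hkxc : Continuous fun y : ℝ => k (x - y) := hkc.comp (continuous_const.sub continuous_id)
  have hk'xc : Continuous fun y : ℝ => k' (x - y) := hk'c.comp (continuous_const.sub continuous_id)
  have hwxc : Continuous fun y : ℝ => w y - w x := hwc.sub continuous_const
  -- the product and the three pieces of its derivative
  have hφ : ∀ y, HasDerivAt (fun y => ((k (x - y) * (w y - w x) : ℝ) : ℂ) * f y)
      (((-k' (x - y) * (w y - w x) + k (x - y) * deriv w y : ℝ) : ℂ) * f y
        + ((k (x - y) * (w y - w x) : ℝ) : ℂ) * f' y) y :=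
    fun y => ((hasDerivAt_kernel_mul_sub hk hw x y).ofReal_comp).mul (hf y)
  have hφi : Integrable (fun y => ((k (x - y) * (w y - w x) : ℝ) : ℂ) * f y) :=
    ((Complex.continuous_ofReal.comp (hkxc.mul hwxc)).mul hfc).integrable_of_hasCompactSupport hfs.mul_left
  have hT1 : Integrable (fun y => ((-k' (x - y) * (w y - w x) : ℝ) : ℂ) * f y) :=
    ((Complex.continuous_ofReal.comp (hk'xc.neg.mul hwxc)).mul hfc).integrable_of_hasCompactSupport hfs.mul_left
  have hT2 : Integrable (fun y => ((k (x - y) * deriv w y : ℝ) : ℂ) * f y) := by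
    have hg : Integrable (fun y => ((k (x - y) : ℝ) : ℂ) * f y) :=
      ((Complex.continuous_ofReal.comp hkxc).mul hfc).integrable_of_hasCompactSupport hfs.mul_left
    have hm : AEStronglyMeasurable (fun y => ((deriv w y : ℝ) : ℂ)) volume :=
      (Complex.continuous_ofReal.measurable.comp (measurable_deriv w)).aestronglyMeasurable
    have hb : ∀ᵐ y ∂volume, ‖((deriv w y : ℝ) : ℂ)‖ ≤ Λ :=
      ae_of_all _ fun y => by rw [Complex.norm_real, Real.norm_eq_abs]; exact hΛ y
    refine (hg.bdd_mul hm hb).congr (ae_of_all _ fun y => ?_)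
    push_cast
    ring
  have hT12 : Integrable (fun y => ((-k' (x - y) * (w y - w x) + k (x - y) * deriv w y : ℝ) : ℂ) * f y) := by
    refine (hT1.add hT2).congr (ae_of_all _ fun y => ?_)
    simp only [Pi.add_apply]
    push_cast
    ring
  have hT3 : Integrable (fun y => ((k (x - y) * (w y - w x) : ℝ) : ℂ) * f' y) :=
    ((Complex.continuous_ofReal.comp (hkxc.mul hwxc)).mul hf'c).integrable_of_hasCompactSupport hf's.mul_left
  have hzero := integral_eq_zero_of_hasDerivAt_of_integrable hφ (hT12.add hT3) hφi
  rw [integral_add hT12 hT3] at hzero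
  have h3 : ∫ y, ((k (x - y) * (w y - w x) : ℝ) : ℂ) * f' y
      = -∫ y, ((-k' (x - y) * (w y - w x) + k (x - y) * deriv w y : ℝ) : ℂ) * f y := by
    linear_combination hzero
  rw [h3, ← integral_neg]
  refine integral_congr_ae (ae_of_all _ fun y => ?_)
  push_cast
  ring

/-- **POINTWISE DOMINATION of the transport commutator**: with `|w′| ≤ Λ`,
`‖∫ k(x−y)(w(y) − w(x)) f′(y) dy‖ ≤ ∫ Λ(|x−y|·|k′(x−y)| + |k(x−y)|)·‖f(y)‖ dy`. [folklore] -/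
theorem norm_transportCommutator_le {k k' : ℝ → ℝ} (hk : ∀ t, HasDerivAt k (k' t) t) (hk'c : Continuous k')
    {w : ℝ → ℝ} (hw : Differentiable ℝ w) {Λ : ℝ} (hΛ : ∀ t, |deriv w t| ≤ Λ)
    {f f' : ℝ → ℂ} (hf : ∀ y, HasDerivAt f (f' y) y) (hf'c : Continuous f') (hfs : HasCompactSupport f) (x : ℝ) :
    ‖∫ y, ((k (x - y) * (w y - w x) : ℝ) : ℂ) * f' y‖
      ≤ ∫ y, (Λ * (|x - y| * |k' (x - y)| + |k (x - y)|)) * ‖f y‖ := by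
  have hkc : Continuous k := continuous_iff_continuousAt.2 fun t => (hk t).continuousAt
  have hfc : Continuous f := continuous_iff_continuousAt.2 fun t => (hf t).continuousAt
  rw [integral_kernel_mul_sub_mul_deriv_eq hk hk'c hw hΛ hf hf'c hfs x]
  have hKc : Continuous fun y : ℝ => Λ * (|x - y| * |k' (x - y)| + |k (x - y)|) :=
    continuous_const.mul (((continuous_const.sub continuous_id).abs.mul
      (hk'c.comp (continuous_const.sub continuous_id)).abs).add (hkc.comp (continuous_const.sub continuous_id)).abs)
  have hint : Integrable (fun y => (Λ * (|x - y| * |k' (x - y)| + |k (x - y)|)) * ‖f y‖) :=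
    (hKc.mul hfc.norm).integrable_of_hasCompactSupport hfs.norm.mul_left
  refine norm_integral_le_of_norm_le hint (ae_of_all _ fun y => ?_)
  rw [norm_mul, Complex.norm_real, Real.norm_eq_abs]
  have hwy : |w y - w x| ≤ Λ * |y - x| := abs_sub_le_of_abs_deriv_le hw hΛ x y
  have hker : |k' (x - y) * (w y - w x) - k (x - y) * deriv w y| ≤ Λ * (|x - y| * |k' (x - y)| + |k (x - y)|) := by
    calc |k' (x - y) * (w y - w x) - k (x - y) * deriv w y|
        ≤ |k' (x - y) * (w y - w x)| + |k (x - y) * deriv w y| := abs_sub _ _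
      _ = |k' (x - y)| * |w y - w x| + |k (x - y)| * |deriv w y| := by rw [abs_mul, abs_mul]
      _ ≤ |k' (x - y)| * (Λ * |y - x|) + |k (x - y)| * Λ := by gcongr; exact hΛ y
      _ = Λ * (|x - y| * |k' (x - y)| + |k (x - y)|) := by rw [abs_sub_comm y x]; ring
  exact mul_le_mul_of_nonneg_right hker (norm_nonneg _)

/-- The commutator `x ↦ ∫ k(x−y)(w(y) − w(x)) f′(y) dy` is a.e.-strongly measurable (a parametric integral of a continuous
integrand). [folklore] -/
theorem aestronglyMeasurable_transportCommutator {k : ℝ → ℝ} (hkc : Continuous k) {w : ℝ → ℝ} (hwc : Continuous w)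
    {f' : ℝ → ℂ} (hf'c : Continuous f') :
    AEStronglyMeasurable (fun x : ℝ => ∫ y, ((k (x - y) * (w y - w x) : ℝ) : ℂ) * f' y) volume := by
  have hF : Continuous fun p : ℝ × ℝ => ((k (p.1 - p.2) * (w p.2 - w p.1) : ℝ) : ℂ) * f' p.2 :=
    (Complex.continuous_ofReal.comp ((hkc.comp (continuous_fst.sub continuous_snd)).mul
      ((hwc.comp continuous_snd).sub (hwc.comp continuous_fst)))).mul (hf'c.comp continuous_snd)
  exact (hF.aestronglyMeasurable (μ := (volume : Measure ℝ).prod volume)).integral_prod_right'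

/-- **`L²` BOUND FOR THE TRANSPORT COMMUTATOR `[k∗, w]∂` (design note §4/§5, "Calderón commutator, needs only `w′ ∈ L∞`").**
For a `C¹` kernel `k` with `k, t·k′(t) ∈ L¹`, a differentiable `w` with `|w′| ≤ Λ`, and `f ∈ C¹_c`:
`∫ ‖∫ k(x−y)(w(y) − w(x)) f′(y) dy‖² dx ≤ (Λ(‖t·k′‖₁ + ‖k‖₁))² ∫‖f‖²` — ORDER ZERO in `f`, with a constant that is invariant under the
scaling `k ↦ μ⁻¹k(·/μ)` (§4 below), i.e. uniform in the core width. [folklore] -/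
theorem integral_sq_norm_transportCommutator_le {k k' : ℝ → ℝ} (hk : ∀ t, HasDerivAt k (k' t) t) (hk'c : Continuous k')
    (hki : Integrable k) (hk'i : Integrable fun t => t * k' t)
    {w : ℝ → ℝ} (hw : Differentiable ℝ w) {Λ : ℝ} (hΛ : ∀ t, |deriv w t| ≤ Λ)
    {f f' : ℝ → ℂ} (hf : ∀ y, HasDerivAt f (f' y) y) (hf'c : Continuous f') (hfs : HasCompactSupport f) :
    MemLp (fun x : ℝ => ∫ y, ((k (x - y) * (w y - w x) : ℝ) : ℂ) * f' y) 2 volume ∧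
      ∫ x, ‖∫ y, ((k (x - y) * (w y - w x) : ℝ) : ℂ) * f' y‖ ^ 2
        ≤ (Λ * ((∫ t, |t| * |k' t|) + ∫ t, |k t|)) ^ 2 * ∫ y, ‖f y‖ ^ 2 := by
  have hkc : Continuous k := continuous_iff_continuousAt.2 fun t => (hk t).continuousAt
  have hfc : Continuous f := continuous_iff_continuousAt.2 fun t => (hf t).continuousAt
  have hΛ0 : 0 ≤ Λ := (abs_nonneg _).trans (hΛ 0)
  set K : ℝ → ℝ := fun t => Λ * (|t| * |k' t| + |k t|) with hK
  have h1 : Integrable fun t => |t| * |k' t| := by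
    refine hk'i.abs.congr (ae_of_all _ fun t => ?_)
    simp only [abs_mul]
  have hKi : Integrable K := (h1.add hki.abs).const_mul Λ
  have hf2 : MemLp f 2 volume := hfc.memLp_of_hasCompactSupport hfs
  have hg := aestronglyMeasurable_transportCommutator hkc hw.continuous hf'c
  have hdom : ∀ᵐ x ∂volume, ‖∫ y, ((k (x - y) * (w y - w x) : ℝ) : ℂ) * f' y‖ ≤ ∫ y, K (x - y) * ‖f y‖ :=
    ae_of_all _ fun x => norm_transportCommutator_le hk hk'c hw hΛ hf hf'c hfs x
  obtain ⟨hgLp, hle⟩ := integral_sq_norm_le_of_norm_le_integral_mul hKi hf2 hg hdom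
  refine ⟨hgLp, hle.trans_eq ?_⟩
  have hKabs : ∫ t, |K t| = Λ * ((∫ t, |t| * |k' t|) + ∫ t, |k t|) := by
    have habs : (fun t => |K t|) = fun t => Λ * (|t| * |k' t| + |k t|) :=
      funext fun t => abs_of_nonneg (by positivity)
    rw [habs, integral_const_mul, integral_add h1 hki.abs]
  rw [hKabs]

/-! ## 3. The zeroth-order (multiplier) commutator `[k∗, B]` for a Lipschitz multiplier `B` -/

/-- The zeroth-order commutator as one integral: `∫ k(x−y)B(y)f(y) dy − B(x)∫ k(x−y)f(y) dy = ∫ k(x−y)(B(y) − B(x))f(y) dy`. [folklore] -/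
theorem integral_kernel_mul_mul_sub_mul_integral {k : ℝ → ℝ} {B f : ℝ → ℂ} {x : ℝ}
    (h1 : Integrable fun y => ((k (x - y) : ℝ) : ℂ) * (B y * f y))
    (h2 : Integrable fun y => ((k (x - y) : ℝ) : ℂ) * f y) :
    (∫ y, ((k (x - y) : ℝ) : ℂ) * (B y * f y)) - B x * ∫ y, ((k (x - y) : ℝ) : ℂ) * f y
      = ∫ y, ((k (x - y) : ℝ) : ℂ) * (B y - B x) * f y := by
  have h3 : (fun y => ((k (x - y) : ℝ) : ℂ) * (B y - B x) * f y)
      = fun y => ((k (x - y) : ℝ) : ℂ) * (B y * f y) - B x * (((k (x - y) : ℝ) : ℂ) * f y) := by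
    ext y
    ring
  rw [h3, integral_sub h1 (h2.const_mul _), integral_const_mul]

/-- **POINTWISE DOMINATION of the multiplier commutator**: `‖B(y) − B(x)‖ ≤ L|y − x|` ⟹
`‖∫ k(x−y)(B(y) − B(x))f(y) dy‖ ≤ ∫ L|x−y|·|k(x−y)|·‖f(y)‖ dy`. [folklore] -/
theorem norm_multiplierCommutator_le {k : ℝ → ℝ} (hkc : Continuous k) {B : ℝ → ℂ} {L : ℝ}
    (hB : ∀ x y, ‖B y - B x‖ ≤ L * |y - x|) {f : ℝ → ℂ} (hfc : Continuous f) (hfs : HasCompactSupport f) (x : ℝ) :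
    ‖∫ y, ((k (x - y) : ℝ) : ℂ) * (B y - B x) * f y‖ ≤ ∫ y, (L * (|x - y| * |k (x - y)|)) * ‖f y‖ := by
  have hKc : Continuous fun y : ℝ => L * (|x - y| * |k (x - y)|) :=
    continuous_const.mul ((continuous_const.sub continuous_id).abs.mul (hkc.comp (continuous_const.sub continuous_id)).abs)
  have hint : Integrable (fun y => (L * (|x - y| * |k (x - y)|)) * ‖f y‖) :=
    (hKc.mul hfc.norm).integrable_of_hasCompactSupport hfs.norm.mul_left
  refine norm_integral_le_of_norm_le hint (ae_of_all _ fun y => ?_)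
  rw [norm_mul, norm_mul, Complex.norm_real, Real.norm_eq_abs]
  calc |k (x - y)| * ‖B y - B x‖ * ‖f y‖ ≤ |k (x - y)| * (L * |y - x|) * ‖f y‖ := by gcongr; exact hB x y
    _ = L * (|x - y| * |k (x - y)|) * ‖f y‖ := by rw [abs_sub_comm y x]; ring

/-- **`L²` BOUND FOR THE MULTIPLIER COMMUTATOR `[k∗, B]` (design note §4, "`‖[χ(μD), B]‖ ≲ μ‖B′‖_∞`").**  For a continuous kernel with
finite first moment `t·k(t) ∈ L¹`, a continuous multiplier with `‖B(y) − B(x)‖ ≤ L|y − x|`, and `f ∈ C_c`: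
`∫ ‖∫ k(x−y)(B(y) − B(x))f(y) dy‖² dx ≤ (L‖t·k‖₁)² ∫‖f‖²`; under `k ↦ μ⁻¹k(·/μ)` the constant scales like `μ` (§4). [folklore] -/
theorem integral_sq_norm_multiplierCommutator_le {k : ℝ → ℝ} (hkc : Continuous k) (hk1 : Integrable fun t => t * k t)
    {B : ℝ → ℂ} (hBc : Continuous B) {L : ℝ} (hB : ∀ x y, ‖B y - B x‖ ≤ L * |y - x|)
    {f : ℝ → ℂ} (hfc : Continuous f) (hfs : HasCompactSupport f) :
    MemLp (fun x : ℝ => ∫ y, ((k (x - y) : ℝ) : ℂ) * (B y - B x) * f y) 2 volume ∧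
      ∫ x, ‖∫ y, ((k (x - y) : ℝ) : ℂ) * (B y - B x) * f y‖ ^ 2
        ≤ (L * ∫ t, |t| * |k t|) ^ 2 * ∫ y, ‖f y‖ ^ 2 := by
  set K : ℝ → ℝ := fun t => L * (|t| * |k t|) with hK
  have h1 : Integrable fun t => |t| * |k t| := by
    refine hk1.abs.congr (ae_of_all _ fun t => ?_)
    simp only [abs_mul]
  have hKi : Integrable K := h1.const_mul L
  have hf2 : MemLp f 2 volume := hfc.memLp_of_hasCompactSupport hfs
  have hF : Continuous fun p : ℝ × ℝ => ((k (p.1 - p.2) : ℝ) : ℂ) * (B p.2 - B p.1) * f p.2 :=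
    ((Complex.continuous_ofReal.comp (hkc.comp (continuous_fst.sub continuous_snd))).mul
      ((hBc.comp continuous_snd).sub (hBc.comp continuous_fst))).mul (hfc.comp continuous_snd)
  have hg : AEStronglyMeasurable (fun x : ℝ => ∫ y, ((k (x - y) : ℝ) : ℂ) * (B y - B x) * f y) volume :=
    (hF.aestronglyMeasurable (μ := (volume : Measure ℝ).prod volume)).integral_prod_right'
  have hdom : ∀ᵐ x ∂volume, ‖∫ y, ((k (x - y) : ℝ) : ℂ) * (B y - B x) * f y‖ ≤ ∫ y, K (x - y) * ‖f y‖ :=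
    ae_of_all _ fun x => norm_multiplierCommutator_le hkc hB hfc hfs x
  obtain ⟨hgLp, hle⟩ := integral_sq_norm_le_of_norm_le_integral_mul hKi hf2 hg hdom
  refine ⟨hgLp, hle.trans ?_⟩
  have hKabs : ∫ t, |K t| = |L| * ∫ t, |t| * |k t| := by
    have habs : (fun t => |K t|) = fun t => |L| * (|t| * |k t|) := funext fun t => by
      rw [hK, abs_mul, abs_of_nonneg (by positivity : 0 ≤ |t| * |k t|)]
    rw [habs, integral_const_mul]
  rw [hKabs]
  have hI : 0 ≤ ∫ y, ‖f y‖ ^ 2 := integral_nonneg fun y => by positivity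
  have hsq : (|L| * ∫ t, |t| * |k t|) ^ 2 = (L * ∫ t, |t| * |k t|) ^ 2 := by rw [mul_pow, mul_pow, sq_abs]
  rw [hsq]

/-! ## 4. Scale invariance of the constants under `k ↦ k_μ := μ⁻¹ k(·/μ)` -/

/-- The scaled kernel `k_μ(t) = μ⁻¹k(t/μ)` has derivative `μ⁻²k′(t/μ)`. [folklore] -/
theorem hasDerivAt_scaledKernel {k k' : ℝ → ℝ} (hk : ∀ t, HasDerivAt k (k' t) t) (μ t : ℝ) :
    HasDerivAt (fun s => μ⁻¹ * k (s / μ)) (μ⁻¹ * (μ⁻¹ * k' (t / μ))) t := by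
  have h1 : HasDerivAt (fun s : ℝ => s / μ) μ⁻¹ t := by
    simpa [div_eq_mul_inv] using (hasDerivAt_id t).mul_const μ⁻¹
  have h2 := (hk (t / μ)).comp t h1
  have h3 : HasDerivAt (fun s => k (s / μ)) (k' (t / μ) * μ⁻¹) t := h2
  exact (h3.const_mul μ⁻¹).congr_deriv (by ring)

/-- `‖k_μ‖₁ = ‖k‖₁`. [folklore] -/
theorem integral_abs_scaledKernel (k : ℝ → ℝ) {μ : ℝ} (hμ : 0 < μ) :
    ∫ t, |μ⁻¹ * k (t / μ)| = ∫ t, |k t| := by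
  have h := Measure.integral_comp_div (fun s => μ⁻¹ * |k s|) μ
  beta_reduce at h
  calc ∫ t, |μ⁻¹ * k (t / μ)| = ∫ t, μ⁻¹ * |k (t / μ)| := by
        refine integral_congr_ae (ae_of_all _ fun t => ?_)
        dsimp only
        rw [abs_mul, abs_of_pos (inv_pos.2 hμ)]
    _ = |μ| • ∫ y, μ⁻¹ * |k y| := h
    _ = ∫ t, |k t| := by
        rw [integral_const_mul, abs_of_pos hμ, smul_eq_mul, ← mul_assoc, mul_inv_cancel₀ hμ.ne', one_mul]

/-- `‖t·k_μ′‖₁ = ‖t·k′‖₁` — the transport-commutator constant is scale-free. [folklore] -/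
theorem integral_abs_mul_abs_deriv_scaledKernel (k' : ℝ → ℝ) {μ : ℝ} (hμ : 0 < μ) :
    ∫ t, |t| * |μ⁻¹ * (μ⁻¹ * k' (t / μ))| = ∫ t, |t| * |k' t| := by
  have h := Measure.integral_comp_div (fun s => μ⁻¹ * (|s| * |k' s|)) μ
  beta_reduce at h
  calc ∫ t, |t| * |μ⁻¹ * (μ⁻¹ * k' (t / μ))| = ∫ t, μ⁻¹ * (|t / μ| * |k' (t / μ)|) := by
        refine integral_congr_ae (ae_of_all _ fun t => ?_)
        dsimp only
        rw [abs_mul, abs_mul, abs_of_pos (inv_pos.2 hμ), abs_div, abs_of_pos hμ]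
        ring
    _ = |μ| • ∫ y, μ⁻¹ * (|y| * |k' y|) := h
    _ = ∫ t, |t| * |k' t| := by
        rw [integral_const_mul, abs_of_pos hμ, smul_eq_mul, ← mul_assoc, mul_inv_cancel₀ hμ.ne', one_mul]

/-- `‖t·k_μ‖₁ = μ‖t·k‖₁` — the multiplier-commutator constant gains the factor `μ`. [folklore] -/
theorem integral_abs_mul_abs_scaledKernel (k : ℝ → ℝ) {μ : ℝ} (hμ : 0 < μ) :
    ∫ t, |t| * |μ⁻¹ * k (t / μ)| = μ * ∫ t, |t| * |k t| := by
  have h := Measure.integral_comp_div (fun s => |s| * |k s|) μ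
  beta_reduce at h
  calc ∫ t, |t| * |μ⁻¹ * k (t / μ)| = ∫ t, |t / μ| * |k (t / μ)| := by
        refine integral_congr_ae (ae_of_all _ fun t => ?_)
        dsimp only
        rw [abs_mul, abs_of_pos (inv_pos.2 hμ), abs_div, abs_of_pos hμ]
        ring
    _ = |μ| • ∫ y, |y| * |k y| := h
    _ = μ * ∫ t, |t| * |k t| := by rw [abs_of_pos hμ, smul_eq_mul]

end Summit.NavierStokesRegularity.NavierStokesRegularity.Theorems.MatchedKernel

end
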